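import Literature.MathematicalPhysics.QuantumFieldTheory.Balaban1983to89.B11Eq94CommutatorBond
import Literature.MathematicalPhysics.QuantumFieldTheory.Balaban1983to89.B11Eq92ByParts

/-!
# `Balaban1983to89.B11Eq92CommutatorFunctional` — T. Bałaban, *The variational problem and background fields in renormalization group method for lattice gauge theories*, Commun. Math. Phys. **102** (1985) 277–309 [Balaban1985Variational]: (92)–(93) p. 292 ON [5]'s ABSTRACT LATTICE — the ONE-BOND FUNCTIONAL `X ↦ (∂/∂A(b)) ½ i tr((DA)(p) Σ_{b₁≺b₂}[A′(b₁),A′(b₂)])·X` of the commutator group as a continuous linear map, its split (92) into the «first term» (curl differentiated) and the «second and third terms» (commutator differentiated), CAUCHY's estimate for the latter, the BOND-LOCAL INTEGRATION BY PARTS (92)→(93) for the former, and the OPERATOR NORM of the functional summed over `st(b)`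

statement-level skeleton of published theorems with citation tags; proofs where landed; nothing here is a claim about the Yang–Mills mass gap

PDF held: `paper:balaban1985-cmp102-variational-background` (journal page = PDF page + 276); p. 292 read by this seat from the `lit read` text layer;
(91)–(96) as transcribed in `B11Eq93Commutator` (r08).

CITATION HEADER (lean-in-tree rule 2026-08-18).  WHAT IS REPRODUCED: (92)–(93) of row `B11.Eq85`'s last group, p. 292: *«The functional
differentiation gives three terms ½⟨DδA′, Σi[A″, A″]⟩ + ½⟨DA′, Σi([δA″, A″] + [A″, δA″])⟩, (92) and the functional derivatives connected with the
second and third terms are estimated easily by O(1)|DA′||A′|. We transform the first term integrating by parts, and we get the functional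
derivative given by ½D*Σi[A″, A″]. (93)»* — for ONE bond variable `A(b)` (print's `δ/δA′(b)`, cf. (90)), on [5]'s abstract lattice, with the
pointwise bound of `D*Σ[A′,A′]` supplied by `B11Eq94CommutatorBond` §2.  SIBLING (r08 gen 9, landed 2026-08-21): `B11Eq92ByParts` proves
(91) → (92) → (93) EXACTLY on the same carrier in the GLOBAL form (a direction `δA′`, summed over all plaquettes: `hasDerivAt_T91`,
`byParts_92_93`, `norm_summand92_le`); THIS file is the BOND-LOCAL form (`δA′ = δ_bX`, one bond variable, the sum over `st(b)`) that the
configuration-valued current of the carrier sequel needs; `B11Eq92ByParts.curlη_add_smul` is reused BY NAME, nothing there re-declared.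

WHAT IS DEFINED AND PROVED (sorry-free; axioms `propext` / `Classical.choice` / `Quot.sound`; one plumbing def `dTerm39Bond`; no `Prop`-valued
definition, no new named fact).
§3 `term39_eq_comm2F`; `norm_comm2F_line_le` (`‖Σ[A′,A′](A + tδ)‖ ≦ (s + |t|Δ)²`, `B11Eq37NormBound.norm_comm2_le_sq`), `differentiable_comm2F_line`,
   **`norm_deriv_frozen_le`** — (92)'s «second and third terms … estimated easily by O(1)|DA′||A′|» BY CAUCHY: the `t`-derivative at 0 of
   `c·τ(D·Σ[A′,A′](A + tδ))` is `≦ 4|c|‖τ‖‖D‖·s·Δ`; **`term39_line_split`** ((92) along a line, with r08's `B11Eq92ByParts.curlη_add_smul`), **`dTerm39Bond`** (the one-bond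
   functional as a CLM, like `B11Eq90V0primeBond.dV0primeBond`), `dTerm39Bond_apply` ((63)), **`dTerm39Bond_apply_split`** ((92));
   `curl_bondDelta_eq_zero_of_not_mem_st`, **`sum_st_parti`** — (92)→(93) BOND-LOCALLY: `Σ_{p∈st(b)} cτ((D^ηδ_bX)(p)·Σ[A′,A′](p)) =
   c·η⁻¹·τ(X·(D¹*Σ[A′,A′])(b))` (`B9Eq39Adjoint.sum_posPlaq_curl_mul` at `A := δ_bX`); **`opNorm_sum_dTerm39Bond_le`** — THE OPERATOR NORM:
   `‖Σ_{p∈st(b)} (∂/∂A(b))term39(A, ∂p)‖ ≦ ‖τ‖(½η⁻¹D + 16(|ι| − 1)G₂s)` for `‖(D¹*Σ[A′,A′])(b)‖ ≦ D`, `|(D^ηA)(p)| ≦ G₂`, `|A|(∂p) ≦ s` on `st(b)`;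
   `differentiable_dTerm39Bond_comp` (the `an₅`-type clause through any continuous linear chart).

HONEST SCOPE — what is NOT claimed.  As `B11Eq94CommutatorBond`: [5]'s abstract carrier and r08's letter conventions; no `HD(A′)` insertions;
hypotheses = unit-ball transports and a tracial `τ`; `D`, `G₂`, `s` letters (instantiated from the (115) weights in the carrier sequel, where
`η⁻¹D = O(1)(|∇A||A| + η|∇A|²)` by `norm_divP_comm2F_le`); constants are witnesses of print's O(1); NOT summit progress (cell pub-balaban: NE9 NOT
PRINTED / NOT PROVED; spine PROVED 0/9).  Unit `b2b-balaban-t4-ne9-formalise-leaf-05` (NE9 crux-team leaf prover, gen 64).  Imports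
`B11Eq94CommutatorBond` and r08's `B11Eq92ByParts` (for `curlη_add_smul`) ONLY.
-/

noncomputable section

open NormedSpace Complex Metric Set Finset Filter Topology

namespace Literature.MathematicalPhysics.QuantumFieldTheory.Balaban1983to89.B11Eq92CommutatorFunctional

open Literature.MathematicalPhysics.QuantumFieldTheory.Balaban1983to89.Beta.TransportVertices
open Literature.MathematicalPhysics.QuantumFieldTheory.Balaban1983to89.B9Eq37Insertion
open Literature.MathematicalPhysics.QuantumFieldTheory.Balaban1983to89.B9Eq39Adjoint
open Literature.MathematicalPhysics.QuantumFieldTheory.Balaban1983to89.B11Eq26ActionExpansion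
open Literature.MathematicalPhysics.QuantumFieldTheory.Balaban1983to89.B11Eq90V0Derivative
open Literature.MathematicalPhysics.QuantumFieldTheory.Balaban1983to89.B11Eq90StB
open Literature.MathematicalPhysics.QuantumFieldTheory.Balaban1983to89.B11Eq90V0primeBond
open Literature.MathematicalPhysics.QuantumFieldTheory.Balaban1983to89.B11Eq94CommutatorBond

/-! ## §3 The one-bond functional of the (39) term: the split (92), Cauchy for (ii), integration by parts for (i) -/

section Functional

variable {𝔸 : Type*} [NormedRing 𝔸] [NormedAlgebra ℂ 𝔸]
variable {S : Type*} [Fintype S] [DecidableEq S] {ι : Type*} [Fintype ι] [LinearOrder ι]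
variable (T : ι → Equiv.Perm S) (U : ι → S → 𝔸ˣ)

omit [Fintype S] [DecidableEq S] [Fintype ι] [LinearOrder ι] in
/-- `term39 = ½ i τ(curlη · Σ[A′,A′])` (`B11Eq90V0primeBond.term39` read through `comm2F`). [cite: Balaban1985Variational, (39) p.284, (91) p.292] -/
theorem term39_eq_comm2F (η : ℝ) (τ : 𝔸 →ₗ[ℂ] ℂ) (A : ι → S → 𝔸) (μ ν : ι) (x : S) :
    term39 T U η τ A μ ν x = (2 : ℂ)⁻¹ * I * τ (curlη T U η A μ ν x * comm2F T U A μ ν x) := rfl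

omit [Fintype S] [DecidableEq S] [Fintype ι] [LinearOrder ι] in
/-- The commutator field along a line: `‖Σ[A′,A′](A + tδ)‖ ≦ (s + |t|Δ)²` (`B11Eq37NormBound.norm_comm2_le_sq`). [cite: Balaban1985Variational, (37) p.284] -/
theorem norm_comm2F_line_le (A δ : ι → S → 𝔸) (t : ℂ) (μ ν : ι) (x : S) {s Δ : ℝ}
    (hs : size (lettersA T U A μ ν x) ≤ s) (hΔ : size (lettersA T U δ μ ν x) ≤ Δ) :
    ‖comm2F T U (A + t • δ) μ ν x‖ ≤ (s + ‖t‖ * Δ) ^ 2 := by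
  have h := size_lettersA_add_smul_le T U A δ t μ ν x
  rw [size_lettersA] at h
  refine B11Eq37NormBound.norm_comm2_le_sq le_rfl le_rfl le_rfl le_rfl ?_
  rw [norm_neg, norm_neg]
  exact h.trans (by gcongr)

omit [Fintype S] [DecidableEq S] [Fintype ι] [LinearOrder ι] in
/-- The commutator field along a line is differentiable in `t` (a quadratic polynomial). [cite: Balaban1985Variational, (92) p.292] -/
theorem differentiable_comm2F_line (A δ : ι → S → 𝔸) (μ ν : ι) (x : S) :
    Differentiable ℂ (fun t : ℂ => comm2F T U (A + t • δ) μ ν x) := by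
  have hR1 := differentiable_R (U ν x)
  have hR2 := differentiable_R (U μ x)
  unfold comm2F B11Eq34BCH.comm2
  simp only [Ring.lie_def, Pi.add_apply, Pi.smul_apply]
  fun_prop

omit [Fintype S] [DecidableEq S] [Fintype ι] [LinearOrder ι] in
/-- **(92)'s «second and third terms … estimated easily by O(1)|DA′||A′|», BY CAUCHY**: with the curl factor FROZEN at `D`, the `t`-derivative at 0
of `t ↦ c·τ(D·Σ[A′,A′](A + tδ))` is `≦ 4‖c‖‖τ‖‖D‖·s·Δ` for `|A|(∂p) ≦ s`, `|δ|(∂p) ≦ Δ` (radius `s/Δ`). [cite: Balaban1985Variational, (92) p.292] -/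
theorem norm_deriv_frozen_le (τ : 𝔸 →L[ℂ] ℂ) (c : ℂ) (D : 𝔸) (A δ : ι → S → 𝔸) (μ ν : ι) (x : S) {s Δ : ℝ}
    (hs : size (lettersA T U A μ ν x) ≤ s) (hΔ : size (lettersA T U δ μ ν x) ≤ Δ) (hs0 : 0 < s) (hΔ0 : 0 < Δ) :
    ‖deriv (fun t : ℂ => c * τ (D * comm2F T U (A + t • δ) μ ν x)) 0‖ ≤ 4 * ‖c‖ * ‖τ‖ * ‖D‖ * s * Δ := by
  have hr : 0 < s / Δ := div_pos hs0 hΔ0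
  have hdiff : Differentiable ℂ (fun t : ℂ => c * τ (D * comm2F T U (A + t • δ) μ ν x)) := by
    have := differentiable_comm2F_line T U A δ μ ν x
    have hτ : Differentiable ℂ (fun X : 𝔸 => τ X) := τ.differentiable
    fun_prop
  have h := Complex.norm_deriv_le_of_forall_mem_sphere_norm_le (C := ‖c‖ * ‖τ‖ * ‖D‖ * (2 * s) ^ 2) hr
    hdiff.diffContOnCl fun z hz => by
      rw [Metric.mem_sphere, dist_zero_right] at hz
      have e : s + ‖z‖ * Δ = 2 * s := by rw [hz, div_mul_cancel₀ s hΔ0.ne']; ring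
      have hc := norm_comm2F_line_le T U A δ z μ ν x hs hΔ
      rw [e] at hc
      calc ‖c * τ (D * comm2F T U (A + z • δ) μ ν x)‖ = ‖c‖ * ‖τ (D * comm2F T U (A + z • δ) μ ν x)‖ := norm_mul _ _
        _ ≤ ‖c‖ * (‖τ‖ * (‖D‖ * (2 * s) ^ 2)) := by
            gcongr
            exact (τ.le_opNorm _).trans (mul_le_mul_of_nonneg_left ((norm_mul_le _ _).trans (by gcongr)) (norm_nonneg _))
        _ = ‖c‖ * ‖τ‖ * ‖D‖ * (2 * s) ^ 2 := by ring
  refine h.trans (le_of_eq ?_)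
  field_simp
  ring

omit [Fintype S] [DecidableEq S] [Fintype ι] [LinearOrder ι] in
/-- **THE SPLIT (92) ALONG A LINE**: `term39(A + tδ) = cτ((D^ηA)(p)·Σ[A′,A′](A + tδ)) + t·cτ((D^ηδ)(p)·Σ[A′,A′](A + tδ))`, `c = ½i` — the first
summand carries the «second and third terms» of (92), the second the «first term». [cite: Balaban1985Variational, (92) p.292] -/
theorem term39_line_split (η : ℝ) (τ : 𝔸 →ₗ[ℂ] ℂ) (A δ : ι → S → 𝔸) (t : ℂ) (μ ν : ι) (x : S) :
    term39 T U η τ (A + t • δ) μ ν x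
      = (2 : ℂ)⁻¹ * I * τ (curlη T U η A μ ν x * comm2F T U (A + t • δ) μ ν x)
        + t * ((2 : ℂ)⁻¹ * I * τ (curlη T U η δ μ ν x * comm2F T U (A + t • δ) μ ν x)) := by
  rw [term39_eq_comm2F, B11Eq92ByParts.curlη_add_smul, add_mul, map_add, smul_mul_assoc, map_smul, smul_eq_mul]
  ring

/-- **THE ONE-BOND FUNCTIONAL OF THE (39) TERM** `X ↦ (∂/∂A(b))term39(A, ∂q)·X` as a continuous linear map (the Fréchet derivative composed with
`B11Eq90V0primeBond.δL`). [cite: Balaban1985Variational, (91)–(92) p.292, (63) p.287] -/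
def dTerm39Bond (η : ℝ) (τ : 𝔸 →L[ℂ] ℂ) (A : ι → S → 𝔸) (q : S × ι × ι) (μ₀ : ι) (x₀ : S) : 𝔸 →L[ℂ] ℂ :=
  (fderiv ℂ (fun B : ι → S → 𝔸 => term39 T U η (τ : 𝔸 →ₗ[ℂ] ℂ) B q.2.1 q.2.2 q.1) A).comp (δL μ₀ x₀)

/-- (63) for the (39) term: the one-bond functional at `X` is the line derivative `(d/dt)term39(A + tδ_bX, ∂q)|₀`. [cite: Balaban1985Variational, (63) p.287] -/
theorem dTerm39Bond_apply (η : ℝ) (τ : 𝔸 →L[ℂ] ℂ) (A : ι → S → 𝔸) (q : S × ι × ι) (μ₀ : ι) (x₀ : S) (X : 𝔸) :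
    dTerm39Bond T U η τ A q μ₀ x₀ X
      = deriv (fun t : ℂ => term39 T U η (τ : 𝔸 →ₗ[ℂ] ℂ) (A + t • bondDelta μ₀ x₀ X) q.2.1 q.2.2 q.1) 0 := by
  rw [dTerm39Bond, ContinuousLinearMap.comp_apply, δL_apply,
    deriv_line_eq_fderiv (((contDiff_term39 T U (n := 1) η τ q.2.1 q.2.2 q.1).differentiable (by norm_num)) A)]

/-- **(92) FOR THE ONE-BOND FUNCTIONAL**: `(∂/∂A(b))term39·X = (d/dt)|₀[cτ((D^ηA)(q)·Σ[A′,A′](A + tδ_bX))] + cτ((D^ηδ_bX)(q)·Σ[A′,A′](A))`.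
[cite: Balaban1985Variational, (92) p.292] -/
theorem dTerm39Bond_apply_split (η : ℝ) (τ : 𝔸 →L[ℂ] ℂ) (A : ι → S → 𝔸) (q : S × ι × ι) (μ₀ : ι) (x₀ : S)
    (X : 𝔸) :
    dTerm39Bond T U η τ A q μ₀ x₀ X
      = deriv (fun t : ℂ => (2 : ℂ)⁻¹ * I * τ (curlη T U η A q.2.1 q.2.2 q.1
            * comm2F T U (A + t • bondDelta μ₀ x₀ X) q.2.1 q.2.2 q.1)) 0
        + (2 : ℂ)⁻¹ * I * τ (curlη T U η (bondDelta μ₀ x₀ X) q.2.1 q.2.2 q.1 * comm2F T U A q.2.1 q.2.2 q.1) := by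
  rw [dTerm39Bond_apply]
  set δ := bondDelta (S := S) μ₀ x₀ X
  have hG : Differentiable ℂ (fun t : ℂ => (2 : ℂ)⁻¹ * I * τ (curlη T U η A q.2.1 q.2.2 q.1
      * comm2F T U (A + t • δ) q.2.1 q.2.2 q.1)) := by
    have := differentiable_comm2F_line T U A δ q.2.1 q.2.2 q.1
    have hτ : Differentiable ℂ (fun X : 𝔸 => τ X) := τ.differentiable
    fun_prop
  have hH : Differentiable ℂ (fun t : ℂ => (2 : ℂ)⁻¹ * I * τ (curlη T U η δ q.2.1 q.2.2 q.1
      * comm2F T U (A + t • δ) q.2.1 q.2.2 q.1)) := by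
    have := differentiable_comm2F_line T U A δ q.2.1 q.2.2 q.1
    have hτ : Differentiable ℂ (fun X : 𝔸 => τ X) := τ.differentiable
    fun_prop
  have e : (fun t : ℂ => term39 T U η (τ : 𝔸 →ₗ[ℂ] ℂ) (A + t • δ) q.2.1 q.2.2 q.1)
      = fun t => (2 : ℂ)⁻¹ * I * τ (curlη T U η A q.2.1 q.2.2 q.1 * comm2F T U (A + t • δ) q.2.1 q.2.2 q.1)
          + t * ((2 : ℂ)⁻¹ * I * τ (curlη T U η δ q.2.1 q.2.2 q.1 * comm2F T U (A + t • δ) q.2.1 q.2.2 q.1)) := by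
    funext t; exact term39_line_split T U η (τ : 𝔸 →ₗ[ℂ] ℂ) A δ t q.2.1 q.2.2 q.1
  rw [e]
  have h1 := (hG 0).hasDerivAt
  have h2 : HasDerivAt (fun t : ℂ => t * ((2 : ℂ)⁻¹ * I * τ (curlη T U η δ q.2.1 q.2.2 q.1
      * comm2F T U (A + t • δ) q.2.1 q.2.2 q.1)))
      ((2 : ℂ)⁻¹ * I * τ (curlη T U η δ q.2.1 q.2.2 q.1 * comm2F T U A q.2.1 q.2.2 q.1)) 0 := by
    have h := (hasDerivAt_id (0 : ℂ)).fun_mul (hH 0).hasDerivAt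
    simpa using h
  rw [(h1.fun_add h2).deriv]

omit [NormedAlgebra ℂ 𝔸] in
/-- A plaquette outside `st(b)` does not see `δ_bX` in its curl. [cite: Balaban1985Variational, (90) p.291] -/
theorem curl_bondDelta_eq_zero_of_not_mem_st (μ₀ : ι) (x₀ : S) (X : 𝔸) {q : S × ι × ι} (hq : q ∈ posPlaq S ι)
    (hst : q ∉ st T μ₀ x₀) : curl T U (bondDelta μ₀ x₀ X) q.2.1 q.2.2 q.1 = 0 := by
  rw [← sum_lettersA, lettersA_bondDelta_of_not_mem_st T U μ₀ x₀ X q hq hst]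
  simp

/-- **(92)→(93) «We transform the first term integrating by parts», BOND-LOCALLY**: summed over `st(b)` (equivalently over all plaquettes), the
«first term» of the one-bond functionals IS the configuration `η⁻¹(D¹*Σ[A′,A′])(b)` paired with `X`:
`Σ_{p∈st(b)} cτ((D^ηδ_bX)(p)·Σ[A′,A′](p)) = c·η⁻¹·τ(X·(D¹*Σ[A′,A′])(b))` (`B9Eq39Adjoint.sum_posPlaq_curl_mul` at `A := δ_bX`).
[cite: Balaban1985Variational, (92)–(93) p.292] -/
theorem sum_st_parti (η : ℝ) (τ : 𝔸 →L[ℂ] ℂ) (hτ : ∀ a b : 𝔸, τ (a * b) = τ (b * a)) (A : ι → S → 𝔸)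
    (μ₀ : ι) (x₀ : S) (X : 𝔸) :
    ∑ q ∈ st T μ₀ x₀, (2 : ℂ)⁻¹ * I * τ (curlη T U η (bondDelta μ₀ x₀ X) q.2.1 q.2.2 q.1 * comm2F T U A q.2.1 q.2.2 q.1)
      = (2 : ℂ)⁻¹ * I * (η : ℂ)⁻¹ * τ (X * divP T U (comm2F T U A) μ₀ x₀) := by
  have hzero : ∀ q ∈ posPlaq S ι, q ∉ st T μ₀ x₀ →
      (2 : ℂ)⁻¹ * I * τ (curlη T U η (bondDelta μ₀ x₀ X) q.2.1 q.2.2 q.1 * comm2F T U A q.2.1 q.2.2 q.1) = 0 := by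
    intro q hq hst
    simp [curlη, curl_bondDelta_eq_zero_of_not_mem_st T U μ₀ x₀ X hq hst]
  rw [Finset.sum_subset (st_subset_posPlaq T μ₀ x₀) hzero]
  simp only [curlη, smul_mul_assoc, map_smul, smul_eq_mul, ← Finset.mul_sum]
  rw [show (∑ q ∈ posPlaq S ι, τ (curl T U (bondDelta μ₀ x₀ X) q.2.1 q.2.2 q.1 * comm2F T U A q.2.1 q.2.2 q.1))
      = τ (X * divP T U (comm2F T U A) μ₀ x₀) from ?_]
  · ring
  have h := sum_posPlaq_curl_mul T U (τ : 𝔸 →ₗ[ℂ] ℂ) hτ (bondDelta μ₀ x₀ X) (comm2F T U A)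
  simp only [ContinuousLinearMap.coe_coe] at h
  rw [h, Finset.sum_eq_single x₀, Finset.sum_eq_single μ₀]
  · simp [bondDelta]
  · intro μ _ hμ; simp [bondDelta, hμ]
  · intro h; exact absurd (Finset.mem_univ _) h
  · intro x _ hx
    refine Finset.sum_eq_zero fun μ _ => ?_
    simp [bondDelta, hx]
  · intro h; exact absurd (Finset.mem_univ _) h


/-- **«Σ_{p∈st(b)}» for the commutator group**: a positively oriented plaquette outside `st(b)` has zero one-bond functional
(`B11Eq90V0primeBond.term39_add_smul_of_letters_zero`). [cite: Balaban1985Variational, (90)–(91) pp.291–292] -/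
theorem dTerm39Bond_eq_zero_of_not_mem_st (η : ℝ) (τ : 𝔸 →L[ℂ] ℂ) (A : ι → S → 𝔸) {q : S × ι × ι}
    (hq : q ∈ posPlaq S ι) {μ₀ : ι} {x₀ : S} (hst : q ∉ st T μ₀ x₀) : dTerm39Bond T U η τ A q μ₀ x₀ = 0 := by
  ext X
  rw [dTerm39Bond_apply, zero_apply]
  have hδ := lettersA_bondDelta_of_not_mem_st T U μ₀ x₀ X q hq hst
  simp only [term39_add_smul_of_letters_zero T U η (τ : 𝔸 →ₗ[ℂ] ℂ) hδ, deriv_const]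

omit [NormedAlgebra ℂ 𝔸] [Fintype S] [DecidableEq S] [Fintype ι] [LinearOrder ι] in
/-- At the zero configuration the commutator field vanishes. [cite: Balaban1985Variational, (91) p.292] -/
theorem comm2F_zero (μ ν : ι) (x : S) : comm2F T U (0 : ι → S → 𝔸) μ ν x = 0 := by
  simp [comm2F, B11Eq34BCH.comm2, R_def, Ring.lie_def]

omit [Fintype S] [DecidableEq S] [Fintype ι] [LinearOrder ι] in
/-- At the zero configuration the curl vanishes. [cite: Balaban1985BackgroundPropagators, (3.4) p.391] -/
theorem curlη_zero (η : ℝ) (μ ν : ι) (x : S) : curlη T U η (0 : ι → S → 𝔸) μ ν x = 0 := by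
  simp [curlη, curl, covD, R_def]

/-- **The one-bond functional of the (39) term vanishes at `A = 0`** (the term is cubic). [cite: Balaban1985Variational, (39) p.284] -/
theorem dTerm39Bond_zero (η : ℝ) (τ : 𝔸 →L[ℂ] ℂ) (q : S × ι × ι) (μ₀ : ι) (x₀ : S) :
    dTerm39Bond T U η τ (0 : ι → S → 𝔸) q μ₀ x₀ = 0 := by
  ext X
  rw [dTerm39Bond_apply_split, zero_apply, comm2F_zero, curlη_zero]
  simp

/-- **THE COMMUTATOR-GROUP ONE-BOND FUNCTIONAL SUMMED OVER `st(b)`: OPERATOR NORM** — «first term» through `η⁻¹(D¹*Σ[A′,A′])(b)` (of norm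
`≦ D`, §2), «second and third terms» through Cauchy per plaquette (`|A|(∂p) ≦ s`, `‖(D^ηA)(p)‖ ≦ G₂` on `st(b)`, `#st(b) ≦ 2(|ι| − 1)`):
`‖Σ_{p∈st(b)} (∂/∂A(b))term39(A, ∂p)‖ ≦ ‖τ‖(½η⁻¹D + 16(|ι| − 1)G₂s)`. [cite: Balaban1985Variational, (91)–(96) p.292] -/
theorem opNorm_sum_dTerm39Bond_le [NormOneClass 𝔸] (hUn : ∀ μ x, ‖(U μ x : 𝔸)‖ ≤ 1 ∧ ‖(((U μ x)⁻¹ : 𝔸ˣ) : 𝔸)‖ ≤ 1)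
    (τ : 𝔸 →L[ℂ] ℂ) (hτ : ∀ a b : 𝔸, τ (a * b) = τ (b * a)) {η : ℝ} (hη : 0 < η) (A : ι → S → 𝔸) (μ₀ : ι) (x₀ : S)
    {s D G₂ : ℝ} (hs0 : 0 < s) (hD0 : 0 ≤ D) (hG0 : 0 ≤ G₂)
    (hs : ∀ q ∈ st T μ₀ x₀, size (lettersA T U A q.2.1 q.2.2 q.1) ≤ s)
    (hG : ∀ q ∈ st T μ₀ x₀, ‖curlη T U η A q.2.1 q.2.2 q.1‖ ≤ G₂)
    (hD : ‖divP T U (comm2F T U A) μ₀ x₀‖ ≤ D) :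
    ‖∑ q ∈ st T μ₀ x₀, dTerm39Bond T U η τ A q μ₀ x₀‖
      ≤ ‖τ‖ * (2⁻¹ * η⁻¹ * D + 16 * (Fintype.card ι - 1 : ℕ) * G₂ * s) := by
  refine ContinuousLinearMap.opNorm_le_bound _ (by positivity) fun X => ?_
  by_cases hX : X = 0
  · subst hX; simp
  have hX0 : 0 < ‖X‖ := norm_pos_iff.2 hX
  rw [_root_.sum_apply]
  simp_rw [dTerm39Bond_apply_split]
  rw [Finset.sum_add_distrib, sum_st_parti T U η τ hτ A μ₀ x₀ X]
  have hii : ∀ q ∈ st T μ₀ x₀, ‖deriv (fun t : ℂ => (2 : ℂ)⁻¹ * I * τ (curlη T U η A q.2.1 q.2.2 q.1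
      * comm2F T U (A + t • bondDelta μ₀ x₀ X) q.2.1 q.2.2 q.1)) 0‖ ≤ 8 * ‖τ‖ * G₂ * s * ‖X‖ := by
    intro q hq
    have h := norm_deriv_frozen_le T U τ ((2 : ℂ)⁻¹ * I) (curlη T U η A q.2.1 q.2.2 q.1) A (bondDelta μ₀ x₀ X)
      q.2.1 q.2.2 q.1 (hs q hq) (size_lettersA_bondDelta_le T U hUn μ₀ x₀ X q.2.1 q.2.2 q.1) hs0 (by positivity)
    have hc : ‖(2 : ℂ)⁻¹ * I‖ = 2⁻¹ := by simp
    rw [hc] at h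
    calc _ ≤ 4 * 2⁻¹ * ‖τ‖ * ‖curlη T U η A q.2.1 q.2.2 q.1‖ * s * (4 * ‖X‖) := h
      _ ≤ 4 * 2⁻¹ * ‖τ‖ * G₂ * s * (4 * ‖X‖) := by gcongr; exact hG q hq
      _ = 8 * ‖τ‖ * G₂ * s * ‖X‖ := by ring
  have hcard := card_st_le T μ₀ x₀
  have hsum : ‖∑ q ∈ st T μ₀ x₀, deriv (fun t : ℂ => (2 : ℂ)⁻¹ * I * τ (curlη T U η A q.2.1 q.2.2 q.1
      * comm2F T U (A + t • bondDelta μ₀ x₀ X) q.2.1 q.2.2 q.1)) 0‖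
      ≤ (2 * (Fintype.card ι - 1) : ℕ) * (8 * ‖τ‖ * G₂ * s * ‖X‖) := by
    refine (norm_sum_le _ _).trans ((Finset.sum_le_sum hii).trans ?_)
    rw [Finset.sum_const, nsmul_eq_mul]
    have : 0 ≤ 8 * ‖τ‖ * G₂ * s * ‖X‖ := by positivity
    gcongr
  have hi : ‖(2 : ℂ)⁻¹ * I * (η : ℂ)⁻¹ * τ (X * divP T U (comm2F T U A) μ₀ x₀)‖ ≤ 2⁻¹ * η⁻¹ * ‖τ‖ * D * ‖X‖ := by
    have hc : ‖(2 : ℂ)⁻¹ * I * (η : ℂ)⁻¹‖ = 2⁻¹ * η⁻¹ := by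
      simp [norm_inv, Complex.norm_real, abs_of_pos hη]
    rw [norm_mul, hc]
    have h1 : ‖τ (X * divP T U (comm2F T U A) μ₀ x₀)‖ ≤ ‖τ‖ * (‖X‖ * D) :=
      (τ.le_opNorm _).trans (mul_le_mul_of_nonneg_left ((norm_mul_le _ _).trans (by gcongr)) (norm_nonneg _))
    calc 2⁻¹ * η⁻¹ * ‖τ (X * divP T U (comm2F T U A) μ₀ x₀)‖ ≤ 2⁻¹ * η⁻¹ * (‖τ‖ * (‖X‖ * D)) := by gcongr
      _ = 2⁻¹ * η⁻¹ * ‖τ‖ * D * ‖X‖ := by ring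
  calc _ ≤ _ := norm_add_le _ _
    _ ≤ (2 * (Fintype.card ι - 1) : ℕ) * (8 * ‖τ‖ * G₂ * s * ‖X‖) + 2⁻¹ * η⁻¹ * ‖τ‖ * D * ‖X‖ := add_le_add hsum hi
    _ = ‖τ‖ * (2⁻¹ * η⁻¹ * D + 16 * (Fintype.card ι - 1 : ℕ) * G₂ * s) * ‖X‖ := by push_cast; ring

/-- The summed functional depends differentiably on the configuration read through any continuous linear chart (term39 is `C²`) — the
carrier sequel's analyticity clause. [cite: Balaban1985Variational, Prop. 4 p.292] -/
theorem differentiable_dTerm39Bond_comp {E : Type*} [NormedAddCommGroup E] [NormedSpace ℂ E]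
    (g : E →L[ℂ] (ι → S → 𝔸)) (η : ℝ) (τ : 𝔸 →L[ℂ] ℂ) (q : S × ι × ι) (μ₀ : ι) (x₀ : S) :
    Differentiable ℂ (fun e : E => dTerm39Bond T U η τ (g e) q μ₀ x₀) := by
  have hF : Differentiable ℂ
      (fderiv ℂ (fun B : ι → S → 𝔸 => term39 T U η (τ : 𝔸 →ₗ[ℂ] ℂ) B q.2.1 q.2.2 q.1)) :=
    ((contDiff_term39 T U (n := 2) η τ q.2.1 q.2.2 q.1).fderiv_right (m := 1) (by norm_num)).differentiable
      (by norm_num)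
  unfold dTerm39Bond
  fun_prop

end Functional

end Literature.MathematicalPhysics.QuantumFieldTheory.Balaban1983to89.B11Eq92CommutatorFunctional

end
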